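import Summits.MatrixMultiplication.MatrixMultiplication.Theorems.SoloBlindPresenceStep

/-!
# General kills for presence families (any corank)

Sub-programme (K₃) / Conjecture E (K3.32).  `S = B ∪ X`, `B` and `X` disjoint, `A_C ⊆ B` a representation of the
shifted target `τ - ∑_{x ∈ C} h x` (`C ⊆ X`).  The three families of "kills" (contradictions with zero-sum-freeness
or H-goodness) that constrain a presence family in every corank, stated once for arbitrary `C`'s (the corank-`≤ 2`
files proved the instances `|C| ≤ 2` by hand):

* `soloBlind_kill_nested` — zsf, `C ⊊ C'` both represented with `A_C ⊆ A_{C'}` ⟹ `(A_{C'} \ A_C) ∪ (C' \ C)` is a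
  zero-sum: so represented chains are antichains on the `B`-side.
* `soloBlind_hgood_disjoint` — H-good, `C ∩ C' = ∅` both represented with `A_C ∩ A_{C'} = ∅` ⟹
  `A_C ∪ A_{C'} ∪ C ∪ C'` sums to `τ + τ`.
* `soloBlind_kill_threefold` — zsf and exponent `3`: `C₁, C₂, C₃` pairwise disjoint, represented by pairwise disjoint
  `A`'s, not everything empty ⟹ `⋃ A_j ∪ ⋃ C_j` sums to `3τ = 0` (the THREE-TERM kill, new at corank `3`).
-/

namespace Summit.MatrixMultiplication.MatrixMultiplication.Theorems

open Finset

universe u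

variable {ι : Type*} [DecidableEq ι]
variable {G : Type u} [AddCommGroup G] [DecidableEq G]

/-- NESTED KILL: represented `C ⊊ C' ⊆ X` with `A_C ⊆ A_{C'}` contradict zero-sum-freeness of `B ∪ X`. -/
theorem soloBlind_kill_nested {h : ι → G} {B X : Finset ι} (hd : Disjoint B X)
    (zsf : ∀ T ⊆ B ∪ X, T.Nonempty → ∑ i ∈ T, h i ≠ 0) {τ : G} {C C' : Finset ι} (hC' : C' ⊆ X)
    (hCC' : C ⊂ C') {A A' : Finset ι} (hA : A ∈ soloBlindSeqRepAll h B (τ - ∑ i ∈ C, h i))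
    (hA' : A' ∈ soloBlindSeqRepAll h B (τ - ∑ i ∈ C', h i)) (hsub : A ⊆ A') : False := by
  obtain ⟨hAB, hAs⟩ := soloBlind_mem_seqRepAll.mp hA
  obtain ⟨hA'B, hA's⟩ := soloBlind_mem_seqRepAll.mp hA'
  obtain ⟨x, hxC', hxC⟩ := Finset.exists_of_ssubset hCC'
  have hdj : Disjoint (A' \ A) (C' \ C) :=
    Finset.disjoint_of_subset_left (Finset.sdiff_subset.trans hA'B)
      (Finset.disjoint_of_subset_right (Finset.sdiff_subset.trans hC') hd)
  refine zsf (A' \ A ∪ C' \ C)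
    (Finset.union_subset (Finset.sdiff_subset.trans (hA'B.trans Finset.subset_union_left))
      (Finset.sdiff_subset.trans (hC'.trans Finset.subset_union_right)))
    ⟨x, Finset.mem_union_right _ (Finset.mem_sdiff.mpr ⟨hxC', hxC⟩)⟩ ?_
  rw [Finset.sum_union hdj, Finset.sum_sdiff_eq_sub hsub, Finset.sum_sdiff_eq_sub hCC'.1, hAs, hA's]
  abel

/-- DISJOINT H-GOOD KILL: represented disjoint `C, C' ⊆ X` with disjoint `A_C, A_{C'}` contradict H-goodness. -/
theorem soloBlind_hgood_disjoint {h : ι → G} {B X : Finset ι} (hd : Disjoint B X) {τ : G}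
    (hgood : ∀ T ⊆ B ∪ X, ∑ i ∈ T, h i ≠ τ + τ) {C C' : Finset ι} (hC : C ⊆ X) (hC' : C' ⊆ X)
    (hCC' : Disjoint C C') {A A' : Finset ι} (hA : A ∈ soloBlindSeqRepAll h B (τ - ∑ i ∈ C, h i))
    (hA' : A' ∈ soloBlindSeqRepAll h B (τ - ∑ i ∈ C', h i)) (hAA' : Disjoint A A') : False := by
  obtain ⟨hAB, hAs⟩ := soloBlind_mem_seqRepAll.mp hA
  obtain ⟨hA'B, hA's⟩ := soloBlind_mem_seqRepAll.mp hA'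
  have hdj : Disjoint (A ∪ A') (C ∪ C') :=
    Finset.disjoint_of_subset_left (Finset.union_subset hAB hA'B)
      (Finset.disjoint_of_subset_right (Finset.union_subset hC hC') hd)
  refine hgood (A ∪ A' ∪ (C ∪ C'))
    (Finset.union_subset ((Finset.union_subset hAB hA'B).trans Finset.subset_union_left)
      ((Finset.union_subset hC hC').trans Finset.subset_union_right)) ?_
  rw [Finset.sum_union hdj, Finset.sum_union hAA', Finset.sum_union hCC', hAs, hA's]
  abel

/-- THREE-TERM KILL (exponent `3`): pairwise disjoint represented `C₁, C₂, C₃ ⊆ X` with pairwise disjoint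
representations, not all of the six sets empty, contradict zero-sum-freeness (`∑ = 3τ = 0`). -/
theorem soloBlind_kill_threefold (three : ∀ g : G, g + g + g = 0) {h : ι → G} {B X : Finset ι}
    (hd : Disjoint B X) (zsf : ∀ T ⊆ B ∪ X, T.Nonempty → ∑ i ∈ T, h i ≠ 0) {τ : G}
    {C₁ C₂ C₃ : Finset ι} (hC₁ : C₁ ⊆ X) (hC₂ : C₂ ⊆ X) (hC₃ : C₃ ⊆ X)
    (c12 : Disjoint C₁ C₂) (c13 : Disjoint C₁ C₃) (c23 : Disjoint C₂ C₃)
    {A₁ A₂ A₃ : Finset ι} (hA₁ : A₁ ∈ soloBlindSeqRepAll h B (τ - ∑ i ∈ C₁, h i))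
    (hA₂ : A₂ ∈ soloBlindSeqRepAll h B (τ - ∑ i ∈ C₂, h i))
    (hA₃ : A₃ ∈ soloBlindSeqRepAll h B (τ - ∑ i ∈ C₃, h i))
    (a12 : Disjoint A₁ A₂) (a13 : Disjoint A₁ A₃) (a23 : Disjoint A₂ A₃)
    (hne : (A₁ ∪ A₂ ∪ A₃ ∪ (C₁ ∪ C₂ ∪ C₃)).Nonempty) : False := by
  obtain ⟨hA₁B, hA₁s⟩ := soloBlind_mem_seqRepAll.mp hA₁
  obtain ⟨hA₂B, hA₂s⟩ := soloBlind_mem_seqRepAll.mp hA₂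
  obtain ⟨hA₃B, hA₃s⟩ := soloBlind_mem_seqRepAll.mp hA₃
  have hAB : A₁ ∪ A₂ ∪ A₃ ⊆ B := Finset.union_subset (Finset.union_subset hA₁B hA₂B) hA₃B
  have hCX : C₁ ∪ C₂ ∪ C₃ ⊆ X := Finset.union_subset (Finset.union_subset hC₁ hC₂) hC₃
  have hdj : Disjoint (A₁ ∪ A₂ ∪ A₃) (C₁ ∪ C₂ ∪ C₃) :=
    Finset.disjoint_of_subset_left hAB (Finset.disjoint_of_subset_right hCX hd)
  have a12_3 : Disjoint (A₁ ∪ A₂) A₃ := Finset.disjoint_union_left.mpr ⟨a13, a23⟩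
  have c12_3 : Disjoint (C₁ ∪ C₂) C₃ := Finset.disjoint_union_left.mpr ⟨c13, c23⟩
  refine zsf _ (Finset.union_subset (hAB.trans Finset.subset_union_left) (hCX.trans Finset.subset_union_right))
    hne ?_
  rw [Finset.sum_union hdj, Finset.sum_union a12_3, Finset.sum_union a12, Finset.sum_union c12_3,
    Finset.sum_union c12, hA₁s, hA₂s, hA₃s]
  have e : τ - ∑ i ∈ C₁, h i + (τ - ∑ i ∈ C₂, h i) + (τ - ∑ i ∈ C₃, h i) +
      (∑ i ∈ C₁, h i + ∑ i ∈ C₂, h i + ∑ i ∈ C₃, h i) = τ + τ + τ := by abel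
  rw [e, three]

/-- The three-term kill with `C₁ = ∅`: `A_∅, A_x, A_y` (`x ≠ y` outside) pairwise disjoint is impossible. -/
theorem soloBlind_kill_threefold_pair (three : ∀ g : G, g + g + g = 0) {h : ι → G} {B X : Finset ι}
    (hd : Disjoint B X) (zsf : ∀ T ⊆ B ∪ X, T.Nonempty → ∑ i ∈ T, h i ≠ 0) {τ : G} {x y : ι}
    (hx : x ∈ X) (hy : y ∈ X) (hxy : x ≠ y) {A₀ A₁ A₂ : Finset ι}
    (hA₀ : A₀ ∈ soloBlindSeqRepAll h B τ) (hA₁ : A₁ ∈ soloBlindSeqRepAll h B (τ - h x))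
    (hA₂ : A₂ ∈ soloBlindSeqRepAll h B (τ - h y))
    (a01 : Disjoint A₀ A₁) (a02 : Disjoint A₀ A₂) (a12 : Disjoint A₁ A₂) : False := by
  refine soloBlind_kill_threefold three hd zsf (C₁ := ∅) (C₂ := {x}) (C₃ := {y}) (Finset.empty_subset X)
    (Finset.singleton_subset_iff.mpr hx) (Finset.singleton_subset_iff.mpr hy)
    (Finset.disjoint_empty_left _) (Finset.disjoint_empty_left _) (Finset.disjoint_singleton.mpr hxy)
    (by simpa using hA₀) (by simpa using hA₁) (by simpa using hA₂) a01 a02 a12 ?_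
  exact ⟨x, by simp⟩

end Summit.MatrixMultiplication.MatrixMultiplication.Theorems
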